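import Literature.Analysis.FluidPDE.TaoFiniteEnergyLerayHopf
import Literature.Analysis.FluidPDE.TaoForcedNormalisedPressure
import Literature.Analysis.FluidPDE.NSVelocityUniqueness
import HarnessLib

/-!
# Finite energy classical solutions of FORCED Navier–Stokes on `ℝ³` are Leray–Hopf solutions
# (Tao 2011, Lemma 8.1 in the sharp form WITH force, with Lemma 4.1 (i)) — the forced twin of
# `TaoFiniteEnergyLerayHopf`

Cell `pub/ns-blowup`, seat `ns-blowup-ecbridge-2` g2; PATH B of the `E–C` endpoint (LIT-DOSSIER §41,
planner WORD STATUS l.1312; lit g6 HANDOFF OPEN (ii): «the LH-packaging THEOREM … is PROVER work, not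
a lit fact»). WHAT THIS IS NOT: not a statement about blow-up — regularity bookkeeping WITH force:
the link «smooth + finite energy ⇒ Leray–Hopf with the energy inequality» that feeds the forced
Serrin–Masuda weak–strong uniqueness `sohr2001_serrinMasuda_uniqueness_forced`
(`ForcedSerrinMasudaUniqueness.lean`).

For a classical solution `(u, p)` of the forced Navier–Stokes system on the closed slab
`[0, T] × ℝ³` (`IsClassicalNSSolutionOn (Icc 0 T) ν f u p`, `ν > 0`, `T > 0`; the force is then
automatically jointly smooth on the slab, `IsClassicalNSSolutionOn.isSmoothSpaceTimeOn_force`) of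
finite energy in Tao's sense ((7): `sup_{t ∈ [0,T]} ∫|u(t)|² < ∞`, arXiv:1108.1165 p. 3), with force
slices uniformly in `L²` (`∫|f(t)|² ≤ C_f`) and force-potential slices uniformly in `L²`
(`∫|Δ⁻¹∇·f(t)|² ≤ Π`; both automatic for Fefferman's class (4)–(5) — see
`ForcePotentialL2Bound.lean` and the cell's `Summits/…/FluidComputer/ClayForceSliceBounds.lean`), this
file proves, GIVEN the printed forced facts Lemma 4.1 (i) `tao2011_forced_pressure_normalisation` and
Lemma 8.1 `tao2011_forced_finiteEnergy_energyBound` (`TaoForcedNormalisedPressure.lean`; named facts,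
taken as hypotheses `hP`, `hL` — the result is CONDITIONAL on them and on nothing else; the estimate
of the pressure term `X₅`, `tao2011_pressureTerm_estimate`, is a theorem of the tree):

* the **forced energy equality** `½‖u(t)‖₂² + ν∫ₛᵗ∫|∇u|² = ½‖u(s)‖₂² + ∫ₛᵗ∫⟪f, u⟫` for all
  `0 ≤ s ≤ t ≤ T` (`IsClassicalNSSolutionOn.energyEq_of_finiteEnergy_forced`) — Leray's
  "relation de dissipation de l'énergie" (Leray 1934, (3.4)) with force, i.e. the sharp form of
  Tao's Lemma 8.1 (arXiv Lemma 44);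
* `u ∈ C([0, T]; L²)`, and
* `u` is a **Leray–Hopf weak solution** on `[0, T)` from `u(0)` WITH force `f`
  (`IsLerayHopfOn T ν f (u 0) u`: weak formulation with `f`, `L^∞L² ∩ L²Ḣ¹`, the energy
  inequalities WITH `∫⟪f,u⟫` — here equalities — from `0` and from every `s`, weak and strong
  `L²` continuity), `IsClassicalNSSolutionOn.isLerayHopfOn_of_finiteEnergy_forced`.

## The argument (forced twin of `TaoFiniteEnergyLerayHopf`, which see)

1. *Energy class* (Lemma 8.1 WITH force, hypothesis `hL`): `sup_t ∫|u(t)|² ≤ A`, `ν∫₀ᵀ∫|∇u|² ≤ A`,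
   `A = C(‖u₀‖₂ + ‖f‖_{L¹L²})² < ∞`; hence `u ∈ L³_{t,x}` by the slice Sobolev bound.
2. *Energy equality.* The localised energy balance of the tree (`energy_balance_cutoff`, stated
   WITH force) against the Tao cut-offs `φ_n` and `n → ∞`: transported energy and viscous cross term
   `O(1/n)` as before; dissipation by dominated convergence; the **force term**
   `∫ₛᵗ∫φ_n⟪f,u⟫ → ∫ₛᵗ∫⟪f,u⟫` by dominated convergence on `(s,t) × ℝ³`
   (`|⟪f,u⟫| ≤ |f||u| ∈ L¹`, Cauchy–Schwarz on the slices: `∫|f||u| ≤ C_f^{1/2}A^{1/2}`); the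
   **pressure term**: by Lemma 4.1 (i) WITH force, for a.e. `τ`,
   `p(τ) = p̃[u(τ)] + Δ⁻¹∇·f(τ) + C(τ)`; the constant drops against the divergence-free `u`, the
   `p̃`-part is handled by the estimate of `X₅` exactly as in the unforced file, and the NEW part
   obeys `|∫ Δ⁻¹∇·f(τ) Dφ_n·u(τ)| ≤ ‖Dφ_n‖_∞ ‖Δ⁻¹∇·f(τ)‖₂ ‖u(τ)‖₂ ≤ (C/(n+1)) Π^{1/2} A^{1/2} → 0`.
3. *Continuity in `L²`*: `|E(t) - E(t₀)| ≤ ν∫_{[t₀,t]}∫|∇u|² + C_f^{1/2}A^{1/2}|t - t₀| → 0`; weak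
   continuity and Radon–Riesz as before (`tendsto_integral_inner_of_continuousOn`,
   `continuousInLpOn_of_energy_of_weak`, reused from the unforced file).
4. *Leray–Hopf structure*: weak formulation WITH force (`isWeakNSSolutionOn_holds`), classical
   gradient as weak gradient, energy inequalities from the equality (the force integral over
   `(s,t)` rewritten as the interval integral `∫ τ in s..t` of `IsLerayHopfOn`).

## Mathlib / tree search

Tree (reused verbatim): `IsClassicalNSSolutionOn.energy_balance_cutoff` and
`isWeakNSSolutionOn_holds` (both WITH force), `taoCutoff_family`, `integral_pressure_shift_eq`,
`ofReal_localisedDissipation_le`, `lintegral_enorm_pow_three_le`, `tendsto_integral_inner_of_continuousOn`,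
`continuousInLpOn_of_energy_of_weak`, `toReal_eLpNorm_two_le`, `tao2011_pressureTerm_estimate_holds`
(`TaoFiniteEnergyLerayHopf`); `tao2011_forced_pressure_normalisation`,
`tao2011_forced_finiteEnergy_energyBound`, `forcePotential` (`TaoForcedNormalisedPressure`);
`integrable_prod_of_continuousOn_of_lintegral`, `norm_integral_integral_le_of_lintegral_le`
(`ClassicalSolutionCalculus`); `lintegral_mul_le_sqrt_mul_sqrt` (`NSVelocityUniqueness`). No forced
`isLerayHopfOn_of_finiteEnergy` in the tree
(`lean search 'isLerayHopfOn_of_finiteEnergy|forced.*LerayHopf'`: only the `f = 0` file and the torus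
steady-force door `LerayHopfForcedOpenStrip`). Mathlib: `ENNReal.lintegral_mul_le_Lp_mul_Lq`,
`tendsto_integral_of_dominated_convergence`, `intervalIntegral.integral_of_le`,
`integral_Ioc_eq_integral_Ioo`.

## References

* T. Tao, *Localisation and compactness properties of the Navier–Stokes global regularity
  problem*, Anal. PDE 6 (2013) 25–107 = arXiv:1108.1165 (`Tao2011`): (6)–(9) pp. 3–5; Lemma 4.1 (i)
  (arXiv Lemma 25, p. 14); Lemma 8.1 (arXiv Lemma 44, p. 24) and its proof, §8, (54), (58)–(65).
* J. Leray, *Sur le mouvement d'un liquide visqueux emplissant l'espace*, Acta Math. 63 (1934)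
  (`Leray1934`): §17 (3.4), §32.
* H. Sohr, *The Navier–Stokes Equations* (Birkhäuser 2001) (`Sohr2001`): Ch. V, (1.5.3) (the energy
  inequality WITH force of a weak solution).
-/

noncomputable section

open MeasureTheory Set Filter Topology
open scoped ENNReal NNReal RealInnerProductSpace

namespace Literature.Analysis.FluidPDE

/-! ## Slices: `L³_{t,x}`, Cauchy–Schwarz, the force majorants -/

section Slices

variable {T ν : ℝ} {f u : ℝ → EuclideanSpace ℝ (Fin 3) → EuclideanSpace ℝ (Fin 3)}
  {p : ℝ → EuclideanSpace ℝ (Fin 3) → ℝ}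

/-- **`u ∈ L³_{t,x}` for finite energy classical solutions with `∇u ∈ L²_{t,x}`** — forced system
(the proof of the unforced `IsClassicalNSSolutionOn.lintegral_enorm_pow_three_lt_top` uses only the
smoothness of the slices). [cite: Tao2011, §8, proof of Lemma 8.1, (58)] -/
theorem IsClassicalNSSolutionOn.lintegral_enorm_pow_three_lt_top_forced
    (h : IsClassicalNSSolutionOn (Icc 0 T) ν f u p) {A : ℝ≥0∞} (hAt : A ≠ ⊤)
    (hA : ∀ t ∈ Icc 0 T, ∫⁻ x, ‖u t x‖ₑ ^ 2 ≤ A)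
    (hgrad : ∫⁻ τ in Ioo 0 T, ∫⁻ x, ENNReal.ofReal (frobeniusNormSq (fderiv ℝ (u τ) x)) < ⊤) :
    ∫⁻ τ in Ioo 0 T, ∫⁻ x, ‖u τ x‖ₑ ^ (3 : ℕ) < ⊤ := by
  set K : ℝ≥0∞ := (SNormLESNormFDerivOfEqConst (EuclideanSpace ℝ (Fin 3))
    (volume : Measure (EuclideanSpace ℝ (Fin 3))) 2 : ℝ≥0∞) with hK
  set c : ℝ≥0∞ := A ^ (3 / 4 : ℝ) * K ^ (3 / 2 : ℝ) with hc
  have hct : c ≠ ⊤ := ENNReal.mul_ne_top (ENNReal.rpow_ne_top_of_nonneg (by norm_num) hAt)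
    (ENNReal.rpow_ne_top_of_nonneg (by norm_num) ENNReal.coe_ne_top)
  have hslice : ∀ τ ∈ Ioo 0 T, ∫⁻ x, ‖u τ x‖ₑ ^ (3 : ℕ) ≤
      c * (1 + ∫⁻ x, ENNReal.ofReal (frobeniusNormSq (fderiv ℝ (u τ) x))) := by
    intro τ hτ
    have hv : ContDiff ℝ 1 (u τ) := (h.contDiff_velocity (Ioo_subset_Icc_self hτ)).of_le (by norm_cast)
    refine (lintegral_enorm_pow_three_le hv (hA τ (Ioo_subset_Icc_self hτ)) hAt).trans ?_
    rw [hc, mul_assoc]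
    gcongr
    exact ENNReal.rpow_three_quarters_le_one_add _
  calc ∫⁻ τ in Ioo 0 T, ∫⁻ x, ‖u τ x‖ₑ ^ (3 : ℕ)
      ≤ ∫⁻ τ in Ioo 0 T, c * (1 + ∫⁻ x, ENNReal.ofReal (frobeniusNormSq (fderiv ℝ (u τ) x))) :=
        setLIntegral_mono' measurableSet_Ioo hslice
    _ = c * (volume (Ioo 0 T) +
          ∫⁻ τ in Ioo 0 T, ∫⁻ x, ENNReal.ofReal (frobeniusNormSq (fderiv ℝ (u τ) x))) := by
        rw [lintegral_const_mul' _ _ hct, lintegral_add_left measurable_const, setLIntegral_const,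
          one_mul]
    _ < ⊤ := by
        refine ENNReal.mul_lt_top hct.lt_top (ENNReal.add_lt_top.2 ⟨?_, hgrad⟩)
        rw [Real.volume_Ioo]; exact ENNReal.ofReal_lt_top

/-- **The force–velocity pairing on a slice**: `∫ |f(τ)||u(τ)| ≤ C_f^{1/2} A^{1/2}` from
`∫|f(τ)|² ≤ C_f`, `∫|u(τ)|² ≤ A` (Cauchy–Schwarz). [cite: Sohr2001, Ch. V (1.5.3)] -/
theorem lintegral_enorm_force_mul_enorm_le {g v : EuclideanSpace ℝ (Fin 3) → EuclideanSpace ℝ (Fin 3)}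
    (hg : Continuous g) (hv : Continuous v) {Cf A : ℝ≥0∞} (hCf : ∫⁻ x, ‖g x‖ₑ ^ 2 ≤ Cf)
    (hA : ∫⁻ x, ‖v x‖ₑ ^ 2 ≤ A) :
    ∫⁻ x, ‖g x‖ₑ * ‖v x‖ₑ ≤ Cf ^ (1 / 2 : ℝ) * A ^ (1 / 2 : ℝ) := by
  refine (lintegral_mul_le_sqrt_mul_sqrt hg.enorm.aemeasurable hv.enorm.aemeasurable).trans ?_
  gcongr

/-- **The force-potential pairing on a slice**: for `π ∈ L²` with `∫|π|² ≤ Π` and a weight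
`|w(x)| ≤ c|v(x)|`, `∫ |π w| ≤ c Π^{1/2} A^{1/2}` (Cauchy–Schwarz). [cite: Tao2011, §8, proof of Lemma 8.1, (54)] -/
theorem lintegral_enorm_potential_mul_le {π : EuclideanSpace ℝ (Fin 3) → ℝ}
    {v : EuclideanSpace ℝ (Fin 3) → EuclideanSpace ℝ (Fin 3)} {w : EuclideanSpace ℝ (Fin 3) → ℝ}
    (hπ : AEStronglyMeasurable π volume) (hv : Continuous v) {Pf A : ℝ≥0∞}
    (hPf : ∫⁻ x, ‖π x‖ₑ ^ 2 ≤ Pf) (hA : ∫⁻ x, ‖v x‖ₑ ^ 2 ≤ A) {c : ℝ} (hc : 0 ≤ c)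
    (hw : ∀ x, |w x| ≤ c * ‖v x‖) :
    ∫⁻ x, ‖π x * w x‖ₑ ≤ ENNReal.ofReal c * (Pf ^ (1 / 2 : ℝ) * A ^ (1 / 2 : ℝ)) := by
  have hpt : ∀ x, ‖π x * w x‖ₑ ≤ ENNReal.ofReal c * (‖π x‖ₑ * ‖v x‖ₑ) := by
    intro x
    rw [enorm_mul, mul_left_comm]
    gcongr
    rw [Real.enorm_eq_ofReal_abs, ← ofReal_norm, ← ENNReal.ofReal_mul hc]
    exact ENNReal.ofReal_le_ofReal (hw x)
  calc ∫⁻ x, ‖π x * w x‖ₑ ≤ ∫⁻ x, ENNReal.ofReal c * (‖π x‖ₑ * ‖v x‖ₑ) := lintegral_mono hpt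
    _ = ENNReal.ofReal c * ∫⁻ x, ‖π x‖ₑ * ‖v x‖ₑ := by
        rw [lintegral_const_mul' _ _ ENNReal.ofReal_ne_top]
    _ ≤ ENNReal.ofReal c * (Pf ^ (1 / 2 : ℝ) * A ^ (1 / 2 : ℝ)) := by
        gcongr
        refine (lintegral_mul_le_sqrt_mul_sqrt hπ.enorm hv.enorm.aemeasurable).trans ?_
        gcongr

/-- A force with slices uniformly in `L²` on `[0,T]` has finite `L¹_t L²_x([0,T] × ℝ³)` norm (Tao's
finite energy data class (6)): `∫₀ᵀ (∫|f(t)|²)^{1/2} dt ≤ T C_f^{1/2} < ∞`. [cite: Tao2011, (6) p. 3] -/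
theorem lintegral_sqrt_force_lt_top {Cf : ℝ≥0∞} (hCft : Cf ≠ ⊤)
    (hCf : ∀ t ∈ Icc 0 T, ∫⁻ x, ‖f t x‖ₑ ^ 2 ≤ Cf) :
    ∫⁻ t in Icc 0 T, (∫⁻ x, ‖f t x‖ₑ ^ 2) ^ (1 / 2 : ℝ) < ⊤ := by
  calc ∫⁻ t in Icc 0 T, (∫⁻ x, ‖f t x‖ₑ ^ 2) ^ (1 / 2 : ℝ)
      ≤ ∫⁻ t in Icc 0 T, Cf ^ (1 / 2 : ℝ) :=
        setLIntegral_mono' measurableSet_Icc fun t ht => by gcongr; exact hCf t ht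
    _ = Cf ^ (1 / 2 : ℝ) * volume (Icc 0 T) := setLIntegral_const _ _
    _ < ⊤ := by
        rw [Real.volume_Icc]
        exact ENNReal.mul_lt_top (ENNReal.rpow_lt_top_of_nonneg (by norm_num) hCft)
          ENNReal.ofReal_lt_top

end Slices


/-! ## The forced energy equality for finite energy classical solutions -/

section Energy

variable {T ν : ℝ} {f u : ℝ → EuclideanSpace ℝ (Fin 3) → EuclideanSpace ℝ (Fin 3)}
  {p : ℝ → EuclideanSpace ℝ (Fin 3) → ℝ}

/-- **The forced pressure slice identity** ((54) WITH force: the constant drops against a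
divergence-free field, the force potential stays): if `q = p̃[v] + π + c` with `π Dφ(v)` integrable,
then `∫ q Dφ(v) = ∫ p̃[v] Dφ(v) + ∫ π Dφ(v)` for compactly supported `C¹` weights `φ`.
[cite: Tao2011, §8, proof of Lemma 8.1, (54), with (9)] -/
theorem integral_forcedPressure_shift_eq {v : EuclideanSpace ℝ (Fin 3) → EuclideanSpace ℝ (Fin 3)}
    (hv : ContDiff ℝ 1 v) (hdiv : VectorCalculus.IsDivFree v)
    {φ : EuclideanSpace ℝ (Fin 3) → ℝ} (hφ : ContDiff ℝ 1 φ) (hφc : HasCompactSupport φ)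
    {q : EuclideanSpace ℝ (Fin 3) → ℝ} (hq : Continuous q) {π : EuclideanSpace ℝ (Fin 3) → ℝ}
    (hπi : Integrable fun x => π x * fderiv ℝ φ x (v x)) {c : ℝ}
    (hqc : ∀ x, q x = normalisedPressure v x + π x + c) :
    ∫ x, q x * fderiv ℝ φ x (v x) =
      (∫ x, normalisedPressure v x * fderiv ℝ φ x (v x)) + ∫ x, π x * fderiv ℝ φ x (v x) := by
  have hvc : Continuous v := hv.continuous
  have hD : Continuous fun x => fderiv ℝ φ x (v x) :=
    (hφ.continuous_fderiv one_ne_zero).clm_apply hvc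
  have hDc : HasCompactSupport fun x => fderiv ℝ φ x (v x) := by
    refine (hφc.fderiv ℝ).mono fun x hx => ?_
    rw [Function.mem_support] at hx ⊢
    contrapose! hx
    rw [hx]
    rfl
  have i1 : Integrable fun x => q x * fderiv ℝ φ x (v x) :=
    (hq.mul hD).integrable_of_hasCompactSupport hDc.mul_left
  have i2 : Integrable fun x => c * fderiv ℝ φ x (v x) :=
    (continuous_const.mul hD).integrable_of_hasCompactSupport hDc.mul_left
  have e : (fun x => normalisedPressure v x * fderiv ℝ φ x (v x)) =
      fun x => q x * fderiv ℝ φ x (v x) - π x * fderiv ℝ φ x (v x) - c * fderiv ℝ φ x (v x) := by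
    funext x
    rw [hqc x]
    ring
  have i3 : Integrable fun x => q x * fderiv ℝ φ x (v x) - π x * fderiv ℝ φ x (v x) := i1.sub hπi
  rw [e, integral_sub i3 i2, integral_sub i1 hπi, integral_const_mul,
    integral_fderiv_apply_eq_zero_of_isDivFree hv hdiv hφ hφc, mul_zero, sub_zero,
    sub_add_cancel]
set_option maxHeartbeats 400000 in -- buildfix (bf3-g25): 160k/180k FAIL, 200k PASS at accept time; line-neutral budget line
/-- **The energy equality for finite energy classical solutions WITH force** (Tao 2011, Lemma 8.1,
sharp form, with Lemma 4.1 (i); Leray 1934, (3.4); Sohr 2001, (1.5.3) with equality). Let `(u, p)`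
be a classical solution of the forced system on `[0, T] × ℝ³` with `sup_t ∫|u(t)|² ≤ A < ⊤`,
`∇u ∈ L²_{t,x}`, `u ∈ L³_{t,x}`, force slices `∫|f(t)|² ≤ C_f < ⊤` and force-potential slices
`Δ⁻¹∇·f(t) ∈ L²` with `∫|Δ⁻¹∇·f(t)|² ≤ Π < ⊤`. Given Tao's forced pressure normalisation (Lemma 4.1
(i), `hP`) and the estimate of the pressure term `X₅` (`hX5`, a theorem of the tree), for
`0 ≤ s ≤ t ≤ T`: `½‖u(t)‖₂² + ν∫ₛᵗ∫|∇u|² = ½‖u(s)‖₂² + ∫ₛᵗ∫⟪f, u⟫`.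
[cite: Tao2011, Lemma 8.1 (proof, §8, (54), (61)–(65)) with Lemma 4.1 (i)] -/
theorem IsClassicalNSSolutionOn.energyEq_of_finiteEnergy_forced
    (hP : tao2011_forced_pressure_normalisation) (hX5 : tao2011_pressureTerm_estimate)
    (h : IsClassicalNSSolutionOn (Icc 0 T) ν f u p) (hν : 0 < ν) (hT : 0 < T)
    {Cf : ℝ≥0∞} (hCft : Cf ≠ ⊤) (hCf : ∀ t ∈ Icc 0 T, ∫⁻ x, ‖f t x‖ₑ ^ 2 ≤ Cf)
    {Pf : ℝ≥0∞} (hPft : Pf ≠ ⊤)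
    (hπm : ∀ t ∈ Icc 0 T, AEStronglyMeasurable (forcePotential (f t)) volume)
    (hπ : ∀ t ∈ Icc 0 T, ∫⁻ x, ‖forcePotential (f t) x‖ₑ ^ 2 ≤ Pf)
    {A : ℝ≥0∞} (hAt : A ≠ ⊤) (hA : ∀ t ∈ Icc 0 T, ∫⁻ x, ‖u t x‖ₑ ^ 2 ≤ A)
    (hgrad : ∫⁻ τ in Ioo 0 T, ∫⁻ x, ENNReal.ofReal (frobeniusNormSq (fderiv ℝ (u τ) x)) < ⊤)
    (hu₃ : ∫⁻ τ in Ioo 0 T, ∫⁻ x, ‖u τ x‖ₑ ^ (3 : ℕ) < ⊤)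
    {s t : ℝ} (hs : 0 ≤ s) (hst : s ≤ t) (ht : t ≤ T) :
    VectorCalculus.kineticEnergy (u t) +
      ν * (∫⁻ τ in Ioo s t, ∫⁻ x, ENNReal.ofReal (frobeniusNormSq (fderiv ℝ (u τ) x))).toReal =
      VectorCalculus.kineticEnergy (u s) + ∫ τ in Ioo s t, ∫ x, ⟪f τ x, u τ x⟫ := by
  set b := stdOrthonormalBasis ℝ (EuclideanSpace ℝ (Fin 3))
  have hU : UniqueDiffOn ℝ (Icc 0 T) := uniqueDiffOn_Icc hT
  have htI : t ∈ Icc 0 T := ⟨hs.trans hst, ht⟩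
  have hsI : s ∈ Icc 0 T := ⟨hs, hst.trans ht⟩
  have hIcc : ∀ {τ}, τ ∈ Ioo s t → τ ∈ Icc 0 T := fun hτ => ⟨hs.trans hτ.1.le, hτ.2.le.trans ht⟩
  have hmem : ∀ τ ∈ Icc 0 T, MemLp (u τ) 2 volume := fun τ hτ =>
    memLp_two_of_lintegral_lt_top (h.contDiff_velocity hτ).continuous ((hA τ hτ).trans_lt hAt.lt_top)
  have hM : ∀ τ ∈ Icc 0 T, eEnergy (u τ) ≤ A := fun τ hτ => hA τ hτ
  have hfs : IsSmoothSpaceTimeOn (Icc 0 T) f := h.isSmoothSpaceTimeOn_force hU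
  -- joint continuity on `[s, t] × E`
  have hsub : Icc s t ×ˢ (univ : Set (EuclideanSpace ℝ (Fin 3))) ⊆ Icc 0 T ×ˢ univ :=
    prod_mono (Icc_subset_Icc hs ht) Subset.rfl
  have cu : ContinuousOn (fun z : ℝ × EuclideanSpace ℝ (Fin 3) => u z.1 z.2) (Icc s t ×ˢ univ) :=
    h.smooth_velocity.continuousOn.mono hsub
  have cDu : ContinuousOn (fun z : ℝ × EuclideanSpace ℝ (Fin 3) => fderiv ℝ (u z.1) z.2)
      (Icc s t ×ˢ univ) :=
    (h.smooth_velocity.fderiv_slice hU).continuousOn.mono hsub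
  have cf : ContinuousOn (fun z : ℝ × EuclideanSpace ℝ (Fin 3) => f z.1 z.2) (Icc s t ×ˢ univ) :=
    (h.continuousOn_force hU).mono hsub
  -- the cut-offs
  obtain ⟨C, hC0', hfam⟩ := taoCutoff_family
  have hC0 : 0 ≤ C := hC0'.le
  have hRpos : ∀ n : ℕ, (0 : ℝ) < n + 1 := fun n => Nat.cast_add_one_pos n
  set φ : ℕ → EuclideanSpace ℝ (Fin 3) → ℝ := fun n x =>
    taoCutoff (4 * ((n : ℝ) + 1)) ((n : ℝ) + 1) x ^ 8 with hφdef
  have hφ1 : ∀ n, ContDiff ℝ 1 (φ n) := fun n => (hfam n).1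
  have hφc : ∀ n, HasCompactSupport (φ n) := fun n => (hfam n).2.1
  have hφle : ∀ n x, |φ n x| ≤ 1 := fun n => (hfam n).2.2.1
  have hφlim : ∀ x, Tendsto (fun n => φ n x) atTop (𝓝 1) := by
    intro x
    obtain ⟨N, hN⟩ := exists_nat_ge (‖x‖ / 3)
    refine tendsto_atTop_of_eventually_const (i₀ := N) fun n hn => ?_
    refine (hfam n).2.2.2.1 x ?_
    have : (N : ℝ) ≤ n := by exact_mod_cast hn
    rw [div_le_iff₀ (by norm_num : (0 : ℝ) < 3)] at hN
    linarith
  have hDφv : ∀ n x v, |fderiv ℝ (φ n) x v| ≤ C / ((n : ℝ) + 1) * ‖v‖ := fun n => (hfam n).2.2.2.2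
  have hc' : ∀ n : ℕ, (0 : ℝ) ≤ C / ((n : ℝ) + 1) := fun n => div_nonneg hC0 (hRpos n).le
  have hrate : ∀ K : ℝ, Tendsto (fun n : ℕ => K * (1 / ((n : ℝ) + 1))) atTop (𝓝 0) := fun K => by
    simpa using (tendsto_one_div_add_atTop_nhds_zero_nat (𝕜 := ℝ)).const_mul K
  -- the identity for each `n`
  have hid := fun n => h.energy_balance_cutoff hT (hφ1 n) (hφc n) hs hst ht
  -- (a) the kinetic terms
  have limE : ∀ {r}, r ∈ Icc 0 T →
      Tendsto (fun n => 2⁻¹ * ∫ x, φ n x * ‖u r x‖ ^ 2) atTop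
        (𝓝 (VectorCalculus.kineticEnergy (u r))) := by
    intro r hr
    have hur : Continuous (u r) := (h.contDiff_velocity hr).continuous
    refine Tendsto.const_mul _ (tendsto_integral_of_dominated_convergence (fun x => ‖u r x‖ ^ 2)
      ?_ ((hmem r hr).integrable_norm_pow two_ne_zero) ?_ ?_)
    · exact fun n => ((hφ1 n).continuous.mul (hur.norm.pow 2)).aestronglyMeasurable
    · refine fun n => Eventually.of_forall fun x => ?_
      rw [Real.norm_eq_abs, abs_mul, abs_of_nonneg (sq_nonneg ‖u r x‖)]
      exact mul_le_of_le_one_left (sq_nonneg _) (hφle n x)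
    · exact Eventually.of_forall fun x => by simpa using (hφlim x).mul_const (‖u r x‖ ^ 2)
  -- (b) the transported kinetic energy `½ ∫∫ (Dφ·u)|u|²` is `O(1/n)`
  have lim1 : Tendsto (fun n => ∫ τ in Ioo s t, ∫ x, fderiv ℝ (φ n) x (u τ x) * ‖u τ x‖ ^ 2)
      atTop (𝓝 0) := by
    set L := ∫⁻ τ in Ioo 0 T, ∫⁻ x, ‖u τ x‖ₑ ^ (3 : ℕ) with hL
    have hLt : L ≠ ⊤ := hu₃.ne
    refine squeeze_zero_norm (a := fun n : ℕ => C * L.toReal * (1 / ((n : ℝ) + 1)))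
      (fun n => ?_) (hrate _)
    have hpt : ∀ τ x, ‖fderiv ℝ (φ n) x (u τ x) * ‖u τ x‖ ^ 2‖ₑ ≤
        ENNReal.ofReal (C / ((n : ℝ) + 1)) * ‖u τ x‖ₑ ^ (3 : ℕ) := fun τ x => by
      rw [Real.enorm_eq_ofReal_abs, ← ofReal_norm, ← ENNReal.ofReal_pow (norm_nonneg _),
        ← ENNReal.ofReal_mul (hc' n)]
      refine ENNReal.ofReal_le_ofReal ?_
      rw [abs_mul, abs_of_nonneg (sq_nonneg ‖u τ x‖)]
      calc |fderiv ℝ (φ n) x (u τ x)| * ‖u τ x‖ ^ 2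
          ≤ C / ((n : ℝ) + 1) * ‖u τ x‖ * ‖u τ x‖ ^ 2 := by gcongr; exact hDφv n x _
        _ = C / ((n : ℝ) + 1) * ‖u τ x‖ ^ 3 := by ring
    have hle : ∫⁻ τ in Ioo s t, ∫⁻ x, ‖fderiv ℝ (φ n) x (u τ x) * ‖u τ x‖ ^ 2‖ₑ ≤
        ENNReal.ofReal (C / ((n : ℝ) + 1)) * L := by
      calc ∫⁻ τ in Ioo s t, ∫⁻ x, ‖fderiv ℝ (φ n) x (u τ x) * ‖u τ x‖ ^ 2‖ₑ
          ≤ ∫⁻ τ in Ioo s t, ∫⁻ x, ENNReal.ofReal (C / ((n : ℝ) + 1)) * ‖u τ x‖ₑ ^ (3 : ℕ) :=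
            lintegral_mono fun τ => lintegral_mono fun x => hpt τ x
        _ = ENNReal.ofReal (C / ((n : ℝ) + 1)) * ∫⁻ τ in Ioo s t, ∫⁻ x, ‖u τ x‖ₑ ^ (3 : ℕ) := by
            simp only [lintegral_const_mul' _ _ ENNReal.ofReal_ne_top]
        _ ≤ ENNReal.ofReal (C / ((n : ℝ) + 1)) * L :=
            mul_le_mul_right (lintegral_Ioo_mono hs ht) _
    refine (norm_integral_integral_le_of_lintegral_le
      (G := fun z : ℝ × EuclideanSpace ℝ (Fin 3) => fderiv ℝ (φ n) z.2 (u z.1 z.2) * ‖u z.1 z.2‖ ^ 2)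
      (ENNReal.mul_ne_top ENNReal.ofReal_ne_top hLt) hle).trans_eq ?_
    rw [ENNReal.toReal_mul, ENNReal.toReal_ofReal (hc' n)]
    ring
  -- (c) the viscous cross term `ν ∫∫ Σᵢ ∂ᵢφ ⟪∂ᵢu, u⟫` is `O(1/n)` (Young's inequality)
  have lim3 : Tendsto (fun n => ∫ τ in Ioo s t, ∫ x, ∑ i, fderiv ℝ (φ n) x (b i) *
      ⟪fderiv ℝ (u τ) x (b i), u τ x⟫) atTop (𝓝 0) := by
    set Lg := ∫⁻ τ in Ioo 0 T, ∫⁻ x, ENNReal.ofReal (frobeniusNormSq (fderiv ℝ (u τ) x)) with hLg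
    set d : ℕ := (Finset.univ : Finset (Fin (Module.finrank ℝ (EuclideanSpace ℝ (Fin 3))))).card
      with hd
    set B : ℝ≥0∞ := Lg + (d : ℝ≥0∞) * A * ENNReal.ofReal T with hB
    have hBt : B ≠ ⊤ := ENNReal.add_ne_top.2 ⟨hgrad.ne, ENNReal.mul_ne_top
      (ENNReal.mul_ne_top (ENNReal.natCast_ne_top d) hAt) ENNReal.ofReal_ne_top⟩
    refine squeeze_zero_norm (a := fun n : ℕ => C * B.toReal * (1 / ((n : ℝ) + 1)))
      (fun n => ?_) (hrate _)
    -- pointwise Young bound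
    have hpt : ∀ τ x, ‖∑ i, fderiv ℝ (φ n) x (b i) * ⟪fderiv ℝ (u τ) x (b i), u τ x⟫‖ₑ ≤
        ENNReal.ofReal (C / ((n : ℝ) + 1)) *
          (ENNReal.ofReal (frobeniusNormSq (fderiv ℝ (u τ) x)) + d * ‖u τ x‖ₑ ^ 2) := by
      intro τ x
      have hreal : |∑ i, fderiv ℝ (φ n) x (b i) * ⟪fderiv ℝ (u τ) x (b i), u τ x⟫| ≤
          C / ((n : ℝ) + 1) * (frobeniusNormSq (fderiv ℝ (u τ) x) + d * ‖u τ x‖ ^ 2) := by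
        calc |∑ i, fderiv ℝ (φ n) x (b i) * ⟪fderiv ℝ (u τ) x (b i), u τ x⟫|
            ≤ ∑ i, |fderiv ℝ (φ n) x (b i) * ⟪fderiv ℝ (u τ) x (b i), u τ x⟫| :=
              Finset.abs_sum_le_sum_abs _ _
          _ ≤ ∑ i, C / ((n : ℝ) + 1) * (‖fderiv ℝ (u τ) x (b i)‖ ^ 2 + ‖u τ x‖ ^ 2) := by
              refine Finset.sum_le_sum fun i _ => ?_
              rw [abs_mul]
              have h1 : |fderiv ℝ (φ n) x (b i)| ≤ C / ((n : ℝ) + 1) := by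
                simpa [b.orthonormal.1 i] using hDφv n x (b i)
              have h2 : |⟪fderiv ℝ (u τ) x (b i), u τ x⟫| ≤
                  ‖fderiv ℝ (u τ) x (b i)‖ ^ 2 + ‖u τ x‖ ^ 2 :=
                (abs_real_inner_le_norm _ _).trans (by
                  nlinarith [sq_nonneg (‖fderiv ℝ (u τ) x (b i)‖ - ‖u τ x‖),
                    norm_nonneg (fderiv ℝ (u τ) x (b i)), norm_nonneg (u τ x)])
              exact mul_le_mul h1 h2 (abs_nonneg _) (hc' n)
          _ = C / ((n : ℝ) + 1) * (frobeniusNormSq (fderiv ℝ (u τ) x) + d * ‖u τ x‖ ^ 2) := by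
              rw [← Finset.mul_sum, Finset.sum_add_distrib, Finset.sum_const, nsmul_eq_mul,
                frobeniusNormSq_eq_sum b]
      rw [Real.enorm_eq_ofReal_abs]
      refine (ENNReal.ofReal_le_ofReal hreal).trans_eq ?_
      rw [ENNReal.ofReal_mul (hc' n), ENNReal.ofReal_add (frobeniusNormSq_nonneg _) (by positivity),
        ENNReal.ofReal_mul (Nat.cast_nonneg _), ENNReal.ofReal_natCast, ← ofReal_norm,
        ← ENNReal.ofReal_pow (norm_nonneg _)]
    -- inner integrals, `τ ∈ (s, t)`
    have hin : ∀ τ ∈ Ioo s t,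
        ∫⁻ x, ‖∑ i, fderiv ℝ (φ n) x (b i) * ⟪fderiv ℝ (u τ) x (b i), u τ x⟫‖ₑ ≤
          ENNReal.ofReal (C / ((n : ℝ) + 1)) *
            ((∫⁻ x, ENNReal.ofReal (frobeniusNormSq (fderiv ℝ (u τ) x))) + d * A) := by
      intro τ hτ
      have hτI := hIcc hτ
      have hmeas : AEMeasurable (fun x => ENNReal.ofReal (frobeniusNormSq (fderiv ℝ (u τ) x)))
          (volume : Measure (EuclideanSpace ℝ (Fin 3))) :=
        (ENNReal.continuous_ofReal.comp (LerayHopfProofs.continuous_frobeniusNormSq.comp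
          ((h.contDiff_velocity hτI).continuous_fderiv (by simp)))).aemeasurable
      calc ∫⁻ x, ‖∑ i, fderiv ℝ (φ n) x (b i) * ⟪fderiv ℝ (u τ) x (b i), u τ x⟫‖ₑ
          ≤ ∫⁻ x, ENNReal.ofReal (C / ((n : ℝ) + 1)) *
              (ENNReal.ofReal (frobeniusNormSq (fderiv ℝ (u τ) x)) + d * ‖u τ x‖ₑ ^ 2) :=
            lintegral_mono fun x => hpt τ x
        _ = ENNReal.ofReal (C / ((n : ℝ) + 1)) *
              ((∫⁻ x, ENNReal.ofReal (frobeniusNormSq (fderiv ℝ (u τ) x))) +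
                d * ∫⁻ x, ‖u τ x‖ₑ ^ 2) := by
            rw [lintegral_const_mul' _ _ ENNReal.ofReal_ne_top, lintegral_add_left' hmeas,
              lintegral_const_mul' _ _ (ENNReal.natCast_ne_top d)]
        _ ≤ ENNReal.ofReal (C / ((n : ℝ) + 1)) *
              ((∫⁻ x, ENNReal.ofReal (frobeniusNormSq (fderiv ℝ (u τ) x))) + d * A) := by
            gcongr
            exact hM τ hτI
    have hle : ∫⁻ τ in Ioo s t,
        ∫⁻ x, ‖∑ i, fderiv ℝ (φ n) x (b i) * ⟪fderiv ℝ (u τ) x (b i), u τ x⟫‖ₑ ≤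
          ENNReal.ofReal (C / ((n : ℝ) + 1)) * B := by
      calc ∫⁻ τ in Ioo s t, ∫⁻ x, ‖∑ i, fderiv ℝ (φ n) x (b i) * ⟪fderiv ℝ (u τ) x (b i), u τ x⟫‖ₑ
          ≤ ∫⁻ τ in Ioo s t, ENNReal.ofReal (C / ((n : ℝ) + 1)) *
              ((∫⁻ x, ENNReal.ofReal (frobeniusNormSq (fderiv ℝ (u τ) x))) + d * A) :=
            setLIntegral_mono' measurableSet_Ioo hin
        _ = ENNReal.ofReal (C / ((n : ℝ) + 1)) *
              ((∫⁻ τ in Ioo s t, ∫⁻ x, ENNReal.ofReal (frobeniusNormSq (fderiv ℝ (u τ) x))) +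
                d * A * volume (Ioo s t)) := by
            rw [lintegral_const_mul' _ _ ENNReal.ofReal_ne_top, lintegral_add_right _ measurable_const,
              setLIntegral_const]
        _ ≤ ENNReal.ofReal (C / ((n : ℝ) + 1)) * B := by
            rw [hB, Real.volume_Ioo]
            gcongr
            · exact lintegral_Ioo_mono hs ht
            · linarith
    refine (norm_integral_integral_le_of_lintegral_le
      (G := fun z : ℝ × EuclideanSpace ℝ (Fin 3) => ∑ i, fderiv ℝ (φ n) z.2 (b i) *
        ⟪fderiv ℝ (u z.1) z.2 (b i), u z.1 z.2⟫)
      (ENNReal.mul_ne_top ENNReal.ofReal_ne_top hBt) hle).trans_eq ?_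
    rw [ENNReal.toReal_mul, ENNReal.toReal_ofReal (hc' n)]
    ring
  -- (d) the pressure flux `∫∫ p (Dφ·u)`: Lemma 4.1 (i) WITH force, the estimate of `X₅`, and the
  -- `L²` bound of the force potential
  have lim4 : Tendsto (fun n => ∫ τ in Ioo s t, ∫ x, p τ x * fderiv ℝ (φ n) x (u τ x))
      atTop (𝓝 0) := by
    have hE' : ∃ C : ℝ≥0, ∀ τ ∈ Icc 0 T, ∫⁻ x, ‖u τ x‖ₑ ^ 2 ≤ C :=
      ⟨A.toNNReal, fun τ hτ => (hA τ hτ).trans (ENNReal.coe_toNNReal hAt).ge⟩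
    obtain ⟨Cp, -, -, hae⟩ := hP hν hT h hfs (lintegral_sqrt_force_lt_top hCft hCf) hE'
    obtain ⟨C₅, hC₅0, h5⟩ := hX5
    set Ar : ℝ := Real.sqrt A.toReal with hAr
    have hAr0 : 0 ≤ Ar := Real.sqrt_nonneg _
    have hAr2 : ENNReal.ofReal (Ar ^ 2) = A := by
      rw [hAr, Real.sq_sqrt ENNReal.toReal_nonneg, ENNReal.ofReal_toReal hAt]
    -- the new constant `Π^{1/2} A^{1/2}` of the force-potential term
    set PA : ℝ≥0∞ := Pf ^ (1 / 2 : ℝ) * A ^ (1 / 2 : ℝ) with hPA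
    have hPAt : PA ≠ ⊤ := ENNReal.mul_ne_top (ENNReal.rpow_ne_top_of_nonneg (by norm_num) hPft)
      (ENNReal.rpow_ne_top_of_nonneg (by norm_num) hAt)
    set G : ℝ → ℝ≥0∞ := fun τ => ∫⁻ x, ENNReal.ofReal (frobeniusNormSq (fderiv ℝ (u τ) x)) with hG
    set Dst : ℝ≥0∞ := ∫⁻ τ in Ioo s t, G τ with hDst
    have hDst : Dst ≠ ⊤ := ((lintegral_Ioo_mono hs ht).trans_lt hgrad).ne
    -- the slice bound, for a.e. `τ ∈ (s, t)` and every `ε > 0`, `n`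
    have hae' : ∀ᵐ τ ∂(volume.restrict (Ioo s t)), ∀ x,
        p τ x = normalisedPressure (u τ) x + forcePotential (f τ) x + Cp τ :=
      ae_restrict_of_ae_restrict_of_subset (Ioo_subset_Icc_self.trans (Icc_subset_Icc hs ht)) hae
    have hslice : ∀ {ε : ℝ} (_ : 0 < ε) (n : ℕ), ∀ᵐ τ ∂(volume.restrict (Ioo s t)),
        ‖∫ x, p τ x * fderiv ℝ (φ n) x (u τ x)‖ₑ ≤
          ENNReal.ofReal ε * G τ +
            ENNReal.ofReal (C₅ * (ε * Ar ^ 2 / ((n : ℝ) + 1) ^ 2 + Ar ^ 6 / (ε ^ 3 * ((n : ℝ) + 1) ^ 4)) +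
              C / ((n : ℝ) + 1) * PA.toReal) := by
      intro ε hε n
      filter_upwards [hae', ae_restrict_mem measurableSet_Ioo] with τ hτ hτm
      have hτI := hIcc hτm
      have hv := h.contDiff_velocity hτI
      have hv1 : ContDiff ℝ 1 (u τ) := hv.of_le (by norm_cast)
      -- the force-potential pairing is integrable and small
      have hw : ∀ x, |fderiv ℝ (φ n) x (u τ x)| ≤ C / ((n : ℝ) + 1) * ‖u τ x‖ := fun x => hDφv n x _
      have hD : Continuous fun x => fderiv ℝ (φ n) x (u τ x) :=
        ((hφ1 n).continuous_fderiv one_ne_zero).clm_apply hv.continuous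
      have hπle := lintegral_enorm_potential_mul_le (hπm τ hτI) hv.continuous (hπ τ hτI) (hA τ hτI)
        (hc' n) hw
      have hπi : Integrable fun x => forcePotential (f τ) x * fderiv ℝ (φ n) x (u τ x) :=
        ⟨(hπm τ hτI).mul hD.aestronglyMeasurable,
          hπle.trans_lt (ENNReal.mul_lt_top ENNReal.ofReal_lt_top hPAt.lt_top)⟩
      have heq := integral_forcedPressure_shift_eq hv1 (h.divFree τ hτI) (hφ1 n) (hφc n)
        (h.contDiff_pressure hτI).continuous hπi hτ
      have hr : (0 : ℝ) < (n : ℝ) + 1 := hRpos n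
      have h5' := h5 (u τ) hv Ar hAr0 (by rw [hAr2]; exact hA τ hτI) (4 * ((n : ℝ) + 1)) ((n : ℝ) + 1)
        hr (by linarith) ε hε
      have h5'' : |∫ x, normalisedPressure (u τ) x * fderiv ℝ (φ n) x (u τ x)| ≤
          ε * localisedDissipation (φ n) (u τ) +
            C₅ * (ε * Ar ^ 2 / ((n : ℝ) + 1) ^ 2 + Ar ^ 6 / (ε ^ 3 * ((n : ℝ) + 1) ^ 4)) := h5'
      have hX : ENNReal.ofReal (localisedDissipation (φ n) (u τ)) ≤ G τ :=
        ofReal_localisedDissipation_le hv1 (hφ1 n).continuous (hφc n)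
          (fun x => taoCutoff_pow_nonneg _ _ x 8) (fun x => taoCutoff_pow_le_one _ _ x 8)
      have hX0 : 0 ≤ ε * localisedDissipation (φ n) (u τ) :=
        mul_nonneg hε.le (localisedDissipation_nonneg (fun x => taoCutoff_pow_nonneg _ _ x 8) _)
      rw [heq]
      refine (enorm_add_le _ _).trans ?_
      have hA1 : ‖∫ x, normalisedPressure (u τ) x * fderiv ℝ (φ n) x (u τ x)‖ₑ ≤
          ENNReal.ofReal ε * G τ +
            ENNReal.ofReal (C₅ * (ε * Ar ^ 2 / ((n : ℝ) + 1) ^ 2 + Ar ^ 6 / (ε ^ 3 * ((n : ℝ) + 1) ^ 4))) := by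
        rw [Real.enorm_eq_ofReal_abs]
        refine (ENNReal.ofReal_le_ofReal h5'').trans ?_
        rw [ENNReal.ofReal_add hX0 (by positivity), ENNReal.ofReal_mul hε.le]
        gcongr
      have hA2 : ‖∫ x, forcePotential (f τ) x * fderiv ℝ (φ n) x (u τ x)‖ₑ ≤
          ENNReal.ofReal (C / ((n : ℝ) + 1) * PA.toReal) := by
        refine (enorm_integral_le_lintegral_enorm _).trans (hπle.trans_eq ?_)
        rw [ENNReal.ofReal_mul (hc' n), ENNReal.ofReal_toReal hPAt]
      calc ‖∫ x, normalisedPressure (u τ) x * fderiv ℝ (φ n) x (u τ x)‖ₑ +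
            ‖∫ x, forcePotential (f τ) x * fderiv ℝ (φ n) x (u τ x)‖ₑ
          ≤ (ENNReal.ofReal ε * G τ +
              ENNReal.ofReal (C₅ * (ε * Ar ^ 2 / ((n : ℝ) + 1) ^ 2 + Ar ^ 6 / (ε ^ 3 * ((n : ℝ) + 1) ^ 4)))) +
              ENNReal.ofReal (C / ((n : ℝ) + 1) * PA.toReal) := add_le_add hA1 hA2
        _ = ENNReal.ofReal ε * G τ +
            ENNReal.ofReal (C₅ * (ε * Ar ^ 2 / ((n : ℝ) + 1) ^ 2 + Ar ^ 6 / (ε ^ 3 * ((n : ℝ) + 1) ^ 4)) +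
              C / ((n : ℝ) + 1) * PA.toReal) := by
            rw [add_assoc, ← ENNReal.ofReal_add (by positivity)
              (mul_nonneg (hc' n) ENNReal.toReal_nonneg)]
    -- hence the bound on the time integral
    have hbound : ∀ {ε : ℝ} (_ : 0 < ε) (n : ℕ),
        |∫ τ in Ioo s t, ∫ x, p τ x * fderiv ℝ (φ n) x (u τ x)| ≤
          ε * Dst.toReal +
            (C₅ * (ε * Ar ^ 2 / ((n : ℝ) + 1) ^ 2 + Ar ^ 6 / (ε ^ 3 * ((n : ℝ) + 1) ^ 4)) +
              C / ((n : ℝ) + 1) * PA.toReal) * (t - s) := by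
      intro ε hε n
      set K₂ : ℝ := C₅ * (ε * Ar ^ 2 / ((n : ℝ) + 1) ^ 2 + Ar ^ 6 / (ε ^ 3 * ((n : ℝ) + 1) ^ 4)) +
        C / ((n : ℝ) + 1) * PA.toReal with hK₂
      have hK₂0 : 0 ≤ K₂ := add_nonneg (by positivity) (mul_nonneg (hc' n) ENNReal.toReal_nonneg)
      have hle : ∫⁻ τ in Ioo s t, ‖∫ x, p τ x * fderiv ℝ (φ n) x (u τ x)‖ₑ ≤
          ENNReal.ofReal ε * Dst + ENNReal.ofReal K₂ * volume (Ioo s t) := by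
        calc ∫⁻ τ in Ioo s t, ‖∫ x, p τ x * fderiv ℝ (φ n) x (u τ x)‖ₑ
            ≤ ∫⁻ τ in Ioo s t, (ENNReal.ofReal ε * G τ + ENNReal.ofReal K₂) :=
              lintegral_mono_ae (hslice hε n)
          _ = ENNReal.ofReal ε * Dst + ENNReal.ofReal K₂ * volume (Ioo s t) := by
              rw [lintegral_add_right _ measurable_const, lintegral_const_mul' _ _ ENNReal.ofReal_ne_top,
                setLIntegral_const]
      have hfin : ENNReal.ofReal ε * Dst + ENNReal.ofReal K₂ * volume (Ioo s t) ≠ ⊤ := by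
        rw [Real.volume_Ioo]
        exact ENNReal.add_ne_top.2 ⟨ENNReal.mul_ne_top ENNReal.ofReal_ne_top hDst,
          ENNReal.mul_ne_top ENNReal.ofReal_ne_top ENNReal.ofReal_ne_top⟩
      have h1 : ‖∫ τ in Ioo s t, ∫ x, p τ x * fderiv ℝ (φ n) x (u τ x)‖ ≤
          (ENNReal.ofReal ε * Dst + ENNReal.ofReal K₂ * volume (Ioo s t)).toReal := by
        refine (norm_integral_le_lintegral_norm _).trans (ENNReal.toReal_mono hfin ?_)
        refine le_trans (lintegral_mono fun τ => ?_) hle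
        rw [ofReal_norm]
      rw [Real.norm_eq_abs] at h1
      refine h1.trans_eq ?_
      rw [Real.volume_Ioo, ENNReal.toReal_add (ENNReal.mul_ne_top ENNReal.ofReal_ne_top hDst)
        (ENNReal.mul_ne_top ENNReal.ofReal_ne_top ENNReal.ofReal_ne_top), ENNReal.toReal_mul,
        ENNReal.toReal_mul, ENNReal.toReal_ofReal hε.le, ENNReal.toReal_ofReal hK₂0,
        ENNReal.toReal_ofReal (by linarith)]
    -- and the limit
    rw [Metric.tendsto_nhds]
    intro δ hδ
    set ε : ℝ := δ / (2 * (Dst.toReal + 1)) with hεdef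
    have hD0 : 0 ≤ Dst.toReal := ENNReal.toReal_nonneg
    have hε : 0 < ε := by positivity
    have hεD : ε * Dst.toReal ≤ δ / 2 := by
      rw [hεdef, div_mul_eq_mul_div, div_le_iff₀ (by positivity)]
      nlinarith
    have hsecond : Tendsto (fun n : ℕ =>
        (C₅ * (ε * Ar ^ 2 / ((n : ℝ) + 1) ^ 2 + Ar ^ 6 / (ε ^ 3 * ((n : ℝ) + 1) ^ 4)) +
          C / ((n : ℝ) + 1) * PA.toReal) * (t - s))
        atTop (𝓝 0) := by
      have h0 : Tendsto (fun n : ℕ => (1 : ℝ) / ((n : ℝ) + 1)) atTop (𝓝 0) :=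
        tendsto_one_div_add_atTop_nhds_zero_nat
      have e : ∀ n : ℕ, (C₅ * (ε * Ar ^ 2 / ((n : ℝ) + 1) ^ 2 + Ar ^ 6 / (ε ^ 3 * ((n : ℝ) + 1) ^ 4)) +
          C / ((n : ℝ) + 1) * PA.toReal) * (t - s) =
          (C₅ * (ε * Ar ^ 2 * (1 / ((n : ℝ) + 1)) ^ 2 + Ar ^ 6 / ε ^ 3 * (1 / ((n : ℝ) + 1)) ^ 4) +
            C * PA.toReal * (1 / ((n : ℝ) + 1))) * (t - s) := by
        intro n
        have : (n : ℝ) + 1 ≠ 0 := (hRpos n).ne'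
        field_simp
      simp_rw [e]
      have := (((((h0.pow 2).const_mul (ε * Ar ^ 2)).add ((h0.pow 4).const_mul (Ar ^ 6 / ε ^ 3))).const_mul
        C₅).add (h0.const_mul (C * PA.toReal))).mul_const (t - s)
      simpa using this
    have hev : ∀ᶠ n : ℕ in atTop,
        |(C₅ * (ε * Ar ^ 2 / ((n : ℝ) + 1) ^ 2 + Ar ^ 6 / (ε ^ 3 * ((n : ℝ) + 1) ^ 4)) +
          C / ((n : ℝ) + 1) * PA.toReal) * (t - s)| < δ / 2 := by
      have h2 := hsecond
      rw [Metric.tendsto_nhds] at h2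
      simpa only [dist_zero_right, Real.norm_eq_abs] using h2 (δ / 2) (half_pos hδ)
    filter_upwards [hev] with n hn
    rw [dist_zero_right, Real.norm_eq_abs]
    calc |∫ τ in Ioo s t, ∫ x, p τ x * fderiv ℝ (φ n) x (u τ x)|
        ≤ ε * Dst.toReal +
            (C₅ * (ε * Ar ^ 2 / ((n : ℝ) + 1) ^ 2 + Ar ^ 6 / (ε ^ 3 * ((n : ℝ) + 1) ^ 4)) +
              C / ((n : ℝ) + 1) * PA.toReal) * (t - s) := hbound hε n
      _ < δ := by
          linarith [le_abs_self ((C₅ * (ε * Ar ^ 2 / ((n : ℝ) + 1) ^ 2 +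
            Ar ^ 6 / (ε ^ 3 * ((n : ℝ) + 1) ^ 4)) + C / ((n : ℝ) + 1) * PA.toReal) * (t - s))]
  -- (e) the dissipation `ν ∫∫ φ |∇u|² → ν ∫∫ |∇u|²` (dominated convergence on `(s, t) × ℝ³`)
  set μ : Measure (ℝ × EuclideanSpace ℝ (Fin 3)) :=
    ((volume : Measure ℝ).restrict (Ioo s t)).prod (volume : Measure (EuclideanSpace ℝ (Fin 3)))
    with hμ
  have lim2 : Tendsto (fun n => ∫ τ in Ioo s t, ∫ x, φ n x * frobeniusNormSq (fderiv ℝ (u τ) x))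
      atTop (𝓝 ((∫⁻ τ in Ioo s t, ∫⁻ x,
        ENNReal.ofReal (frobeniusNormSq (fderiv ℝ (u τ) x))).toReal)) := by
    have cG : ContinuousOn (fun z : ℝ × EuclideanSpace ℝ (Fin 3) =>
        frobeniusNormSq (fderiv ℝ (u z.1) z.2)) (Icc s t ×ˢ univ) :=
      LerayHopfProofs.continuous_frobeniusNormSq.comp_continuousOn cDu
    have hGi : Integrable (fun z : ℝ × EuclideanSpace ℝ (Fin 3) =>
        frobeniusNormSq (fderiv ℝ (u z.1) z.2)) μ := by
      refine integrable_prod_of_continuousOn_of_lintegral cG ?_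
      calc ∫⁻ τ in Ioo s t, ∫⁻ x, ‖frobeniusNormSq (fderiv ℝ (u τ) x)‖ₑ
          = ∫⁻ τ in Ioo s t, ∫⁻ x, ENNReal.ofReal (frobeniusNormSq (fderiv ℝ (u τ) x)) := by
            simp only [Real.enorm_eq_ofReal (frobeniusNormSq_nonneg _)]
        _ ≤ ∫⁻ τ in Ioo 0 T, ∫⁻ x, ENNReal.ofReal (frobeniusNormSq (fderiv ℝ (u τ) x)) :=
            lintegral_Ioo_mono hs ht
        _ < ⊤ := hgrad
    have hFn : ∀ n, Integrable (fun z : ℝ × EuclideanSpace ℝ (Fin 3) =>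
        φ n z.2 * frobeniusNormSq (fderiv ℝ (u z.1) z.2)) μ := fun n =>
      hGi.mono' (aestronglyMeasurable_prod_of_continuousOn
        ((((hφ1 n).continuous.comp continuous_snd).continuousOn).mul cG))
        (Eventually.of_forall fun z => by
          rw [norm_mul, Real.norm_eq_abs, Real.norm_of_nonneg (frobeniusNormSq_nonneg _)]
          exact mul_le_of_le_one_left (frobeniusNormSq_nonneg _) (hφle n _))
    have hval : ∀ n, ∫ τ in Ioo s t, ∫ x, φ n x * frobeniusNormSq (fderiv ℝ (u τ) x) =
        ∫ z, φ n z.2 * frobeniusNormSq (fderiv ℝ (u z.1) z.2) ∂μ := fun n =>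
      (integral_prod _ (hFn n)).symm
    have hlimval : (∫⁻ τ in Ioo s t, ∫⁻ x, ENNReal.ofReal (frobeniusNormSq (fderiv ℝ (u τ) x))).toReal
        = ∫ z, frobeniusNormSq (fderiv ℝ (u z.1) z.2) ∂μ := by
      rw [integral_eq_lintegral_of_nonneg_ae (Eventually.of_forall fun z => frobeniusNormSq_nonneg _)
        hGi.aestronglyMeasurable, lintegral_prod _ hGi.aestronglyMeasurable.aemeasurable.ennreal_ofReal]
    rw [hlimval]
    refine (tendsto_integral_of_dominated_convergence
      (fun z : ℝ × EuclideanSpace ℝ (Fin 3) => frobeniusNormSq (fderiv ℝ (u z.1) z.2))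
      (fun n => (hFn n).aestronglyMeasurable) hGi (fun n => Eventually.of_forall fun z => ?_)
      (Eventually.of_forall fun z => ?_)).congr fun n => (hval n).symm
    · rw [norm_mul, Real.norm_eq_abs, Real.norm_of_nonneg (frobeniusNormSq_nonneg _)]
      exact mul_le_of_le_one_left (frobeniusNormSq_nonneg _) (hφle n _)
    · simpa using (hφlim z.2).mul_const (frobeniusNormSq (fderiv ℝ (u z.1) z.2))
  -- (f) the force term `∫∫ φ ⟪f, u⟫ → ∫∫ ⟪f, u⟫` (dominated convergence on `(s, t) × ℝ³`)
  have lim5 : Tendsto (fun n => ∫ τ in Ioo s t, ∫ x, φ n x * ⟪f τ x, u τ x⟫)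
      atTop (𝓝 (∫ τ in Ioo s t, ∫ x, ⟪f τ x, u τ x⟫)) := by
    have cF : ContinuousOn (fun z : ℝ × EuclideanSpace ℝ (Fin 3) => ⟪f z.1 z.2, u z.1 z.2⟫)
        (Icc s t ×ˢ univ) := cf.inner cu
    set CA : ℝ≥0∞ := Cf ^ (1 / 2 : ℝ) * A ^ (1 / 2 : ℝ) with hCA
    have hCAt : CA ≠ ⊤ := ENNReal.mul_ne_top (ENNReal.rpow_ne_top_of_nonneg (by norm_num) hCft)
      (ENNReal.rpow_ne_top_of_nonneg (by norm_num) hAt)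
    have hFi : Integrable (fun z : ℝ × EuclideanSpace ℝ (Fin 3) => ⟪f z.1 z.2, u z.1 z.2⟫) μ := by
      refine integrable_prod_of_continuousOn_of_lintegral cF ?_
      calc ∫⁻ τ in Ioo s t, ∫⁻ x, ‖⟪f τ x, u τ x⟫‖ₑ
          ≤ ∫⁻ τ in Ioo s t, ∫⁻ x, ‖f τ x‖ₑ * ‖u τ x‖ₑ := by
            refine lintegral_mono fun τ => lintegral_mono fun x => ?_
            rw [← ofReal_norm, ← ofReal_norm, ← ofReal_norm, ← ENNReal.ofReal_mul (norm_nonneg _)]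
            exact ENNReal.ofReal_le_ofReal (norm_inner_le_norm _ _)
        _ ≤ ∫⁻ τ in Ioo s t, CA := by
            refine setLIntegral_mono' measurableSet_Ioo fun τ hτ => ?_
            have hτI := hIcc hτ
            exact lintegral_enorm_force_mul_enorm_le (h.continuous_force_slice hU hτI)
              (h.contDiff_velocity hτI).continuous (hCf τ hτI) (hA τ hτI)
        _ = CA * volume (Ioo s t) := setLIntegral_const _ _
        _ < ⊤ := by
            rw [Real.volume_Ioo]; exact ENNReal.mul_lt_top hCAt.lt_top ENNReal.ofReal_lt_top
    have hFn : ∀ n, Integrable (fun z : ℝ × EuclideanSpace ℝ (Fin 3) =>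
        φ n z.2 * ⟪f z.1 z.2, u z.1 z.2⟫) μ := fun n =>
      hFi.norm.mono' (aestronglyMeasurable_prod_of_continuousOn
        ((((hφ1 n).continuous.comp continuous_snd).continuousOn).mul cF))
        (Eventually.of_forall fun z => by
          rw [norm_mul, Real.norm_eq_abs, Real.norm_eq_abs]
          exact mul_le_of_le_one_left (abs_nonneg _) (hφle n _))
    have hval : ∀ n, ∫ τ in Ioo s t, ∫ x, φ n x * ⟪f τ x, u τ x⟫ =
        ∫ z, φ n z.2 * ⟪f z.1 z.2, u z.1 z.2⟫ ∂μ := fun n => (integral_prod _ (hFn n)).symm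
    have hlimval : ∫ τ in Ioo s t, ∫ x, ⟪f τ x, u τ x⟫ = ∫ z, ⟪f z.1 z.2, u z.1 z.2⟫ ∂μ :=
      (integral_prod _ hFi).symm
    rw [hlimval]
    refine (tendsto_integral_of_dominated_convergence
      (fun z : ℝ × EuclideanSpace ℝ (Fin 3) => ‖⟪f z.1 z.2, u z.1 z.2⟫‖)
      (fun n => (hFn n).aestronglyMeasurable) hFi.norm (fun n => Eventually.of_forall fun z => ?_)
      (Eventually.of_forall fun z => ?_)).congr fun n => (hval n).symm
    · rw [norm_mul, Real.norm_eq_abs, Real.norm_eq_abs]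
      exact mul_le_of_le_one_left (abs_nonneg _) (hφle n _)
    · simpa using (hφlim z.2).mul_const (⟪f z.1 z.2, u z.1 z.2⟫)
  -- (g) pass to the limit in the identity
  have hLHS := (limE htI).sub (limE hsI)
  have hRHS := ((((lim1.const_mul (2⁻¹ : ℝ)).sub (lim2.const_mul ν)).sub (lim3.const_mul ν)).add
    lim4).add lim5
  have heq := tendsto_nhds_unique hLHS (hRHS.congr fun n => (hid n).symm)
  linarith

end Energy


/-! ## Continuity in `L²` (forced energy balance) -/

section Continuity

variable {T ν : ℝ} {f u : ℝ → EuclideanSpace ℝ (Fin 3) → EuclideanSpace ℝ (Fin 3)}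
  {p : ℝ → EuclideanSpace ℝ (Fin 3) → ℝ}

/-- **The time-integrated force–velocity pairing**: for `0 ≤ s ≤ t ≤ T`,
`∫ₛᵗ∫ |⟪f, u⟫| ≤ C_f^{1/2} A^{1/2} (t - s)` (slice-wise Cauchy–Schwarz). [cite: Sohr2001, Ch. V (1.5.3)] -/
theorem IsClassicalNSSolutionOn.lintegral_inner_force_le (h : IsClassicalNSSolutionOn (Icc 0 T) ν f u p)
    (hT : 0 < T) {Cf : ℝ≥0∞} (hCf : ∀ t ∈ Icc 0 T, ∫⁻ x, ‖f t x‖ₑ ^ 2 ≤ Cf)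
    {A : ℝ≥0∞} (hA : ∀ t ∈ Icc 0 T, ∫⁻ x, ‖u t x‖ₑ ^ 2 ≤ A)
    {s t : ℝ} (hs : 0 ≤ s) (ht : t ≤ T) :
    ∫⁻ τ in Ioo s t, ∫⁻ x, ‖⟪f τ x, u τ x⟫‖ₑ ≤
      Cf ^ (1 / 2 : ℝ) * A ^ (1 / 2 : ℝ) * ENNReal.ofReal (t - s) := by
  have hU : UniqueDiffOn ℝ (Icc 0 T) := uniqueDiffOn_Icc hT
  have hIcc : ∀ {τ}, τ ∈ Ioo s t → τ ∈ Icc 0 T := fun hτ => ⟨hs.trans hτ.1.le, hτ.2.le.trans ht⟩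
  calc ∫⁻ τ in Ioo s t, ∫⁻ x, ‖⟪f τ x, u τ x⟫‖ₑ
      ≤ ∫⁻ τ in Ioo s t, ∫⁻ x, ‖f τ x‖ₑ * ‖u τ x‖ₑ := by
        refine lintegral_mono fun τ => lintegral_mono fun x => ?_
        rw [← ofReal_norm, ← ofReal_norm, ← ofReal_norm, ← ENNReal.ofReal_mul (norm_nonneg _)]
        exact ENNReal.ofReal_le_ofReal (norm_inner_le_norm _ _)
    _ ≤ ∫⁻ τ in Ioo s t, Cf ^ (1 / 2 : ℝ) * A ^ (1 / 2 : ℝ) := by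
        refine setLIntegral_mono' measurableSet_Ioo fun τ hτ => ?_
        have hτI := hIcc hτ
        exact lintegral_enorm_force_mul_enorm_le (h.continuous_force_slice hU hτI)
          (h.contDiff_velocity hτI).continuous (hCf τ hτI) (hA τ hτI)
    _ = Cf ^ (1 / 2 : ℝ) * A ^ (1 / 2 : ℝ) * ENNReal.ofReal (t - s) := by
        rw [setLIntegral_const, Real.volume_Ioo]

/-- **The force work over `(s, t)` is `O(t - s)`**: `|∫ₛᵗ∫⟪f,u⟫| ≤ (C_f^{1/2}A^{1/2}) (t - s)`.
[cite: Sohr2001, Ch. V (1.5.3)] -/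
theorem IsClassicalNSSolutionOn.abs_integral_inner_force_le
    (h : IsClassicalNSSolutionOn (Icc 0 T) ν f u p) (hT : 0 < T)
    {Cf : ℝ≥0∞} (hCft : Cf ≠ ⊤) (hCf : ∀ t ∈ Icc 0 T, ∫⁻ x, ‖f t x‖ₑ ^ 2 ≤ Cf)
    {A : ℝ≥0∞} (hAt : A ≠ ⊤) (hA : ∀ t ∈ Icc 0 T, ∫⁻ x, ‖u t x‖ₑ ^ 2 ≤ A)
    {s t : ℝ} (hs : 0 ≤ s) (hst : s ≤ t) (ht : t ≤ T) :
    |∫ τ in Ioo s t, ∫ x, ⟪f τ x, u τ x⟫| ≤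
      (Cf ^ (1 / 2 : ℝ) * A ^ (1 / 2 : ℝ)).toReal * (t - s) := by
  have hCAt : Cf ^ (1 / 2 : ℝ) * A ^ (1 / 2 : ℝ) ≠ ⊤ :=
    ENNReal.mul_ne_top (ENNReal.rpow_ne_top_of_nonneg (by norm_num) hCft)
      (ENNReal.rpow_ne_top_of_nonneg (by norm_num) hAt)
  have h1 := norm_integral_integral_le_of_lintegral_le
    (G := fun z : ℝ × EuclideanSpace ℝ (Fin 3) => ⟪f z.1 z.2, u z.1 z.2⟫)
    (ENNReal.mul_ne_top hCAt ENNReal.ofReal_ne_top) (h.lintegral_inner_force_le hT hCf hA hs ht)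
  rw [Real.norm_eq_abs, ENNReal.toReal_mul, ENNReal.toReal_ofReal (by linarith)] at h1
  exact h1

/-- **Continuity of the energy under a forced energy balance.** If `∇u ∈ L²_{t,x}` and for all
`0 ≤ s ≤ t ≤ T`, `|E(t) + ν∫ₛᵗ∫|∇u|² - E(s)| ≤ M (t - s)`, then `t ↦ E(t) = ½‖u(t)‖₂²` is
continuous on `[0, T]` (absolute continuity of the dissipation integral plus the Lipschitz bound
of the force work). [cite: Sohr2001, Ch. V (1.5.3)] -/
theorem tendsto_kineticEnergy_of_energyIneq_forced {ν M : ℝ} (hM : 0 ≤ M)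
    (hgrad : ∫⁻ τ in Ioo 0 T, ∫⁻ x, ENNReal.ofReal (frobeniusNormSq (fderiv ℝ (u τ) x)) < ⊤)
    (hE : ∀ {s t : ℝ}, 0 ≤ s → s ≤ t → t ≤ T → |VectorCalculus.kineticEnergy (u t) +
      ν * (∫⁻ τ in Ioo s t, ∫⁻ x, ENNReal.ofReal (frobeniusNormSq (fderiv ℝ (u τ) x))).toReal -
      VectorCalculus.kineticEnergy (u s)| ≤ M * (t - s))
    {t₀ : ℝ} (ht₀ : t₀ ∈ Icc 0 T) :
    Tendsto (fun t => VectorCalculus.kineticEnergy (u t)) (𝓝[Icc 0 T] t₀)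
      (𝓝 (VectorCalculus.kineticEnergy (u t₀))) := by
  set G : ℝ → ℝ≥0∞ := fun τ => ∫⁻ x, ENNReal.ofReal (frobeniusNormSq (fderiv ℝ (u τ) x)) with hG
  set μ : Measure ℝ := volume.restrict (Ioo 0 T) with hμ
  -- the symmetric interval around `t₀`
  set I : ℝ → Set ℝ := fun t => Ioo (min t₀ t) (max t₀ t) with hI
  have habs : Tendsto (fun t : ℝ => |t - t₀|) (𝓝[Icc 0 T] t₀) (𝓝 0) := by
    have : Tendsto (fun t : ℝ => |t - t₀|) (𝓝 t₀) (𝓝 0) := by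
      have hc : Continuous fun t : ℝ => |t - t₀| := (continuous_id.sub continuous_const).abs
      simpa using hc.tendsto t₀
    exact this.mono_left nhdsWithin_le_nhds
  have hvol : Tendsto (μ ∘ I) (𝓝[Icc 0 T] t₀) (𝓝 0) := by
    have h1 : ∀ t, (μ ∘ I) t ≤ ENNReal.ofReal |t - t₀| := by
      intro t
      simp only [Function.comp, hμ, hI]
      calc volume.restrict (Ioo 0 T) (Ioo (min t₀ t) (max t₀ t))
          ≤ volume (Ioo (min t₀ t) (max t₀ t)) := Measure.restrict_apply_le _ _
        _ = ENNReal.ofReal |t - t₀| := by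
            rw [Real.volume_Ioo, max_sub_min_eq_abs', abs_sub_comm]
    have h2 : Tendsto (fun t => ENNReal.ofReal |t - t₀|) (𝓝[Icc 0 T] t₀) (𝓝 0) := by
      have h3 := (ENNReal.continuous_ofReal.tendsto 0).comp habs
      rw [ENNReal.ofReal_zero] at h3
      exact h3
    exact tendsto_of_tendsto_of_tendsto_of_le_of_le tendsto_const_nhds h2 (fun _ => bot_le) h1
  have hac := tendsto_setLIntegral_zero (μ := μ) (f := G) hgrad.ne hvol
  -- `|E(t) - E(t₀)| ≤ |ν| (∫_{I t} G).toReal + M |t - t₀|`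
  have hdiff : ∀ t ∈ Icc 0 T,
      |VectorCalculus.kineticEnergy (u t) - VectorCalculus.kineticEnergy (u t₀)| ≤
        |ν| * (∫⁻ τ in I t, G τ ∂μ).toReal + M * |t - t₀| := by
    intro t ht
    have hrestr : ∀ {a b : ℝ}, 0 ≤ a → b ≤ T → ∫⁻ τ in Ioo a b, G τ ∂μ = ∫⁻ τ in Ioo a b, G τ := by
      intro a b ha hb
      rw [hμ, Measure.restrict_restrict measurableSet_Ioo,
        inter_eq_left.2 (Ioo_subset_Ioo ha hb)]
    rcases le_total t₀ t with h0 | h0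
    · have e := hE ht₀.1 h0 ht.2
      rw [hI]
      simp only [min_eq_left h0, max_eq_right h0]
      rw [hrestr ht₀.1 ht.2, abs_of_nonneg (sub_nonneg.2 h0)]
      set D := (∫⁻ τ in Ioo t₀ t, G τ).toReal with hD
      have hD0 : 0 ≤ D := ENNReal.toReal_nonneg
      have : VectorCalculus.kineticEnergy (u t) - VectorCalculus.kineticEnergy (u t₀) =
          (VectorCalculus.kineticEnergy (u t) + ν * D - VectorCalculus.kineticEnergy (u t₀)) - ν * D := by
        ring
      rw [this]
      refine (abs_sub _ _).trans ?_
      rw [abs_mul, abs_of_nonneg hD0]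
      linarith
    · have e := hE ht.1 h0 ht₀.2
      rw [hI]
      simp only [min_eq_right h0, max_eq_left h0]
      rw [hrestr ht.1 ht₀.2, abs_sub_comm (VectorCalculus.kineticEnergy (u t)), abs_sub_comm t t₀,
        abs_of_nonneg (sub_nonneg.2 h0)]
      set D := (∫⁻ τ in Ioo t t₀, G τ).toReal with hD
      have hD0 : 0 ≤ D := ENNReal.toReal_nonneg
      have : VectorCalculus.kineticEnergy (u t₀) - VectorCalculus.kineticEnergy (u t) =
          (VectorCalculus.kineticEnergy (u t₀) + ν * D - VectorCalculus.kineticEnergy (u t)) - ν * D := by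
        ring
      rw [this]
      refine (abs_sub _ _).trans ?_
      rw [abs_mul, abs_of_nonneg hD0]
      linarith
  rw [Metric.tendsto_nhds]
  intro δ hδ
  have hfin : ∀ᶠ t in 𝓝[Icc 0 T] t₀, (∫⁻ τ in I t, G τ ∂μ).toReal < δ / (2 * (|ν| + 1)) := by
    have h1 : Tendsto (fun t => (∫⁻ τ in I t, G τ ∂μ).toReal) (𝓝[Icc 0 T] t₀) (𝓝 0) := by
      rw [← ENNReal.toReal_zero]
      exact (ENNReal.tendsto_toReal ENNReal.zero_ne_top).comp hac
    rw [Metric.tendsto_nhds] at h1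
    filter_upwards [h1 (δ / (2 * (|ν| + 1))) (by positivity)] with t ht
    rw [dist_zero_right, Real.norm_of_nonneg ENNReal.toReal_nonneg] at ht
    exact ht
  have hnear : ∀ᶠ t in 𝓝[Icc 0 T] t₀, |t - t₀| < δ / (2 * (M + 1)) := by
    rw [Metric.tendsto_nhds] at habs
    filter_upwards [habs (δ / (2 * (M + 1))) (by positivity)] with t ht
    rw [dist_zero_right, Real.norm_of_nonneg (abs_nonneg _)] at ht
    exact ht
  filter_upwards [hfin, hnear, eventually_mem_nhdsWithin] with t h1 h2 ht
  rw [Real.dist_eq]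
  have hν1 : |ν| * (∫⁻ τ in I t, G τ ∂μ).toReal ≤ |ν| * (δ / (2 * (|ν| + 1))) :=
    mul_le_mul_of_nonneg_left h1.le (abs_nonneg ν)
  have hν2 : |ν| * (δ / (2 * (|ν| + 1))) < δ / 2 := by
    rw [mul_div_assoc', div_lt_div_iff₀ (by positivity) (by positivity)]
    nlinarith [abs_nonneg ν]
  have hM1 : M * |t - t₀| ≤ M * (δ / (2 * (M + 1))) := mul_le_mul_of_nonneg_left h2.le hM
  have hM2 : M * (δ / (2 * (M + 1))) < δ / 2 ∨ M = 0 := by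
    rcases eq_or_lt_of_le hM with h0 | h0
    · exact Or.inr h0.symm
    · left
      rw [mul_div_assoc', div_lt_div_iff₀ (by positivity) (by positivity)]
      nlinarith
  calc |VectorCalculus.kineticEnergy (u t) - VectorCalculus.kineticEnergy (u t₀)|
      ≤ |ν| * (∫⁻ τ in I t, G τ ∂μ).toReal + M * |t - t₀| := hdiff t ht
    _ < δ := by
        rcases hM2 with hM2 | hM0
        · linarith
        · rw [hM0, zero_mul, add_zero]; linarith

end Continuity

/-! ## Finite energy classical solutions of the forced system are Leray–Hopf solutions -/

section Assembly

variable {T ν : ℝ} {f u : ℝ → EuclideanSpace ℝ (Fin 3) → EuclideanSpace ℝ (Fin 3)}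
  {p : ℝ → EuclideanSpace ℝ (Fin 3) → ℝ}

/-- The force integral of the localised balance over `(s, t)` is the interval integral
`∫ τ in s..t` of `IsLerayHopfOn` (`s ≤ t`). [folklore] -/
private theorem intervalIntegral_eq_integral_Ioo {g : ℝ → ℝ} {s t : ℝ} (hst : s ≤ t) :
    ∫ τ in s..t, g τ = ∫ τ in Ioo s t, g τ := by
  rw [intervalIntegral.integral_of_le hst, integral_Ioc_eq_integral_Ioo]

/-- **Finite energy classical solutions of FORCED Navier–Stokes are Leray–Hopf solutions — core
statement.** Given Tao's forced pressure normalisation (Lemma 4.1 (i) WITH force, `hP`) and the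
estimate of the pressure term `X₅` (`hX5`, a theorem of the tree), a classical solution of the
forced system on `[0, T] × ℝ³` with `sup_t ∫|u(t)|² ≤ A < ∞`, `∇u ∈ L²_{t,x}`, force slices
`∫|f(t)|² ≤ C_f < ∞` and force-potential slices `∫|Δ⁻¹∇·f(t)|² ≤ Π < ∞` is a Leray–Hopf weak solution
on `[0, T)` from `u(0)` WITH force `f` (energy *equality* with the work term `∫⟪f,u⟫` from every
time), and `u ∈ C([0,T]; L²)`. [cite: Tao2011, Lemma 8.1 + Lemma 4.1 (i), with (9)] -/
theorem IsClassicalNSSolutionOn.isLerayHopfOn_of_finiteEnergy_forced'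
    (hP : tao2011_forced_pressure_normalisation) (hX5 : tao2011_pressureTerm_estimate)
    (h : IsClassicalNSSolutionOn (Icc 0 T) ν f u p) (hν : 0 < ν) (hT : 0 < T)
    {Cf : ℝ≥0∞} (hCft : Cf ≠ ⊤) (hCf : ∀ t ∈ Icc 0 T, ∫⁻ x, ‖f t x‖ₑ ^ 2 ≤ Cf)
    {Pf : ℝ≥0∞} (hPft : Pf ≠ ⊤)
    (hπm : ∀ t ∈ Icc 0 T, AEStronglyMeasurable (forcePotential (f t)) volume)
    (hπ : ∀ t ∈ Icc 0 T, ∫⁻ x, ‖forcePotential (f t) x‖ₑ ^ 2 ≤ Pf)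
    {A : ℝ≥0∞} (hAt : A ≠ ⊤) (hA : ∀ t ∈ Icc 0 T, ∫⁻ x, ‖u t x‖ₑ ^ 2 ≤ A)
    (hgrad : ∫⁻ τ in Ioo 0 T, ∫⁻ x, ENNReal.ofReal (frobeniusNormSq (fderiv ℝ (u τ) x)) < ⊤) :
    IsLerayHopfOn T ν f (u 0) u ∧ ContinuousInLpOn (Icc 0 T) 2 u := by
  have h0I : (0 : ℝ) ∈ Icc 0 T := left_mem_Icc.2 hT.le
  have hfilter : 𝓝[>] (0 : ℝ) ≤ 𝓝[Icc 0 T] 0 :=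
    nhdsWithin_le_of_mem (mem_of_superset (Ioo_mem_nhdsGT hT) Ioo_subset_Icc_self)
  have hu₃ := h.lintegral_enorm_pow_three_lt_top_forced hAt hA hgrad
  have hmem : ∀ t ∈ Icc 0 T, MemLp (u t) 2 volume := fun t ht =>
    memLp_two_of_lintegral_lt_top (h.contDiff_velocity ht).continuous ((hA t ht).trans_lt hAt.lt_top)
  -- the forced energy equality on every `[s, t] ⊆ [0, T]`
  have hE : ∀ {s t : ℝ}, 0 ≤ s → s ≤ t → t ≤ T → VectorCalculus.kineticEnergy (u t) +
      ν * (∫⁻ τ in Ioo s t, ∫⁻ x, ENNReal.ofReal (frobeniusNormSq (fderiv ℝ (u τ) x))).toReal =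
      VectorCalculus.kineticEnergy (u s) + ∫ τ in Ioo s t, ∫ x, ⟪f τ x, u τ x⟫ :=
    fun hs hst ht => h.energyEq_of_finiteEnergy_forced hP hX5 hν hT hCft hCf hPft hπm hπ hAt hA
      hgrad hu₃ hs hst ht
  -- the force work is `O(t - s)`
  set M : ℝ := (Cf ^ (1 / 2 : ℝ) * A ^ (1 / 2 : ℝ)).toReal with hMdef
  have hM0 : 0 ≤ M := ENNReal.toReal_nonneg
  have hEabs : ∀ {s t : ℝ}, 0 ≤ s → s ≤ t → t ≤ T → |VectorCalculus.kineticEnergy (u t) +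
      ν * (∫⁻ τ in Ioo s t, ∫⁻ x, ENNReal.ofReal (frobeniusNormSq (fderiv ℝ (u τ) x))).toReal -
      VectorCalculus.kineticEnergy (u s)| ≤ M * (t - s) := by
    intro s t hs hst ht
    rw [hE hs hst ht, add_sub_cancel_left]
    exact h.abs_integral_inner_force_le hT hCft hCf hAt hA hs hst ht
  -- continuity in `L²`
  have hKE : ∀ t₀ ∈ Icc 0 T, Tendsto (fun t => VectorCalculus.kineticEnergy (u t))
      (𝓝[Icc 0 T] t₀) (𝓝 (VectorCalculus.kineticEnergy (u t₀))) :=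
    fun t₀ ht₀ => tendsto_kineticEnergy_of_energyIneq_forced hM0 hgrad hEabs ht₀
  have hweak : ∀ {w : EuclideanSpace ℝ (Fin 3) → EuclideanSpace ℝ (Fin 3)} (_ : MemLp w 2 volume)
      (t₀ : ℝ) (_ : t₀ ∈ Icc 0 T),
      Tendsto (fun t => ∫ x, ⟪u t x, w x⟫) (𝓝[Icc 0 T] t₀) (𝓝 (∫ x, ⟪u t₀ x, w x⟫)) :=
    fun hw t₀ ht₀ => tendsto_integral_inner_of_continuousOn h.smooth_velocity.continuousOn hmem
      ENNReal.toReal_nonneg (fun t ht => toReal_eLpNorm_two_le hAt (hA t ht)) hw ht₀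
  have hcont : ContinuousInLpOn (Icc 0 T) 2 u := continuousInLpOn_of_energy_of_weak hmem hKE hweak
  refine ⟨⟨IsClassicalNSSolutionOn.isWeakNSSolutionOn_holds h Subset.rfl, ⟨A.toNNReal, ?_⟩, hmem,
    ⟨fun t => fderiv ℝ (u t), ?_, hgrad, fun t ht => ?_, ?_⟩, fun w hw => ⟨?_, ?_⟩, ?_⟩, hcont⟩
  · -- energy bound a.e. on `(0, T)`
    refine (ae_restrict_iff' measurableSet_Ioo).2 (Eventually.of_forall fun t ht => ?_)
    rw [ENNReal.coe_toNNReal hAt]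
    exact hA t (Ioo_subset_Icc_self ht)
  · -- the classical gradient is a weak gradient
    exact (ae_restrict_iff' measurableSet_Ioo).2 (Eventually.of_forall fun t ht =>
      hasWeakGradient_fderiv_of_contDiff
        (contDiff_infty.1 (h.contDiff_velocity (Ioo_subset_Icc_self ht)) 1))
  · -- energy (in)equality from `0`, WITH the work of the force
    rw [intervalIntegral_eq_integral_Ioo ht.1]
    exact (hE le_rfl ht.1 ht.2).le
  · -- energy (in)equality from every `s ∈ (0, T)`
    exact (ae_restrict_iff' measurableSet_Ioo).2 (Eventually.of_forall fun s hs t ht => by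
      rw [intervalIntegral_eq_integral_Ioo ht.1]
      exact (hE hs.1.le ht.1 ht.2).le)
  · -- weak continuity on `(0, T]`
    intro t ht
    exact (hweak hw t (Ioc_subset_Icc_self ht)).mono_left (nhdsWithin_mono _ Ioc_subset_Icc_self)
  · -- weak attainment of the datum
    exact (hweak hw 0 h0I).mono_left hfilter
  · -- strong attainment of the datum
    exact (hcont.2 0 h0I).mono_left hfilter

/-- **The energy class from Lemma 8.1 WITH force** (`tao2011_forced_finiteEnergy_energyBound`,
hypothesis `hL`): `sup_t ∫|u(t)|² ≤ A`, `ν∫₀ᵀ∫|∇u|² ≤ A`, `A = C(‖u₀‖₂ + ‖f‖_{L¹_tL²_x})² < ∞`, for a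
finite energy classical solution of the forced system whose force slices are uniformly in `L²`.
[cite: Tao2011, Lemma 8.1 (arXiv Lemma 44) with (6)–(8)] -/
theorem IsClassicalNSSolutionOn.energyClass_of_finiteEnergy_forced
    (hL : tao2011_forced_finiteEnergy_energyBound)
    (h : IsClassicalNSSolutionOn (Icc 0 T) ν f u p) (hν : 0 < ν) (hT : 0 < T)
    {Cf : ℝ≥0∞} (hCft : Cf ≠ ⊤) (hCf : ∀ t ∈ Icc 0 T, ∫⁻ x, ‖f t x‖ₑ ^ 2 ≤ Cf)
    (hfe : ∃ A : ℝ≥0∞, A < ⊤ ∧ ∀ t ∈ Icc 0 T, ∫⁻ x, ‖u t x‖ₑ ^ 2 ≤ A) :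
    ∃ A : ℝ≥0∞, A ≠ ⊤ ∧ (∀ t ∈ Icc 0 T, ∫⁻ x, ‖u t x‖ₑ ^ 2 ≤ A) ∧
      ENNReal.ofReal ν * ∫⁻ τ in Ioo 0 T, ∫⁻ x, ENNReal.ofReal (frobeniusNormSq (fderiv ℝ (u τ) x)) ≤ A ∧
      ∫⁻ τ in Ioo 0 T, ∫⁻ x, ENNReal.ofReal (frobeniusNormSq (fderiv ℝ (u τ) x)) < ⊤ := by
  obtain ⟨C, hC, hmain⟩ := hL
  obtain ⟨A₀, hA₀, hA₀t⟩ := hfe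
  have hfs : IsSmoothSpaceTimeOn (Icc 0 T) f := h.isSmoothSpaceTimeOn_force (uniqueDiffOn_Icc hT)
  have hfE := lintegral_sqrt_force_lt_top hCft hCf
  have hE' : ∃ C : ℝ≥0, ∀ t ∈ Icc 0 T, ∫⁻ x, ‖u t x‖ₑ ^ 2 ≤ C :=
    ⟨A₀.toNNReal, fun t ht => (hA₀t t ht).trans (ENNReal.coe_toNNReal hA₀.ne).ge⟩
  obtain ⟨hEt, hD⟩ := hmain hν hT h hfs hfE hE'
  set A := C * ((∫⁻ x, ‖u 0 x‖ₑ ^ 2) ^ (1 / 2 : ℝ) +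
    ∫⁻ t in Icc 0 T, (∫⁻ x, ‖f t x‖ₑ ^ 2) ^ (1 / 2 : ℝ)) ^ 2 with hAdef
  have hAt : A ≠ ⊤ := by
    refine ENNReal.mul_ne_top hC.ne (ENNReal.pow_ne_top (ENNReal.add_ne_top.2 ⟨?_, hfE.ne⟩))
    exact ENNReal.rpow_ne_top_of_nonneg (by norm_num) ((hA₀t 0 ⟨le_rfl, hT.le⟩).trans_lt hA₀).ne
  have hν' : ENNReal.ofReal ν ≠ 0 := (ENNReal.ofReal_pos.2 hν).ne'
  have hgrad : ∫⁻ τ in Ioo 0 T, ∫⁻ x, ENNReal.ofReal (frobeniusNormSq (fderiv ℝ (u τ) x)) < ⊤ := by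
    have hle : ∫⁻ τ in Ioo 0 T, ∫⁻ x, ENNReal.ofReal (frobeniusNormSq (fderiv ℝ (u τ) x)) ≤
        A / ENNReal.ofReal ν := by
      rw [ENNReal.le_div_iff_mul_le (Or.inl hν') (Or.inl ENNReal.ofReal_ne_top), mul_comm]
      exact hD
    exact hle.trans_lt (ENNReal.div_lt_top hAt hν')
  exact ⟨A, hAt, hEt, hD, hgrad⟩

/-- **Finite energy classical solutions of FORCED Navier–Stokes on `ℝ³` are Leray–Hopf solutions**
(Tao 2011, Lemma 8.1 in the sharp form with Lemma 4.1 (i), both WITH force; Leray 1934, §32; the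
input "`u` satisfies the energy inequality (1.5.3)" of Sohr's Serrin–Masuda theorem V.1.5.1). GIVEN
the two printed forced facts — Lemma 4.1 (i) `tao2011_forced_pressure_normalisation` (`hP`) and
Lemma 8.1 `tao2011_forced_finiteEnergy_energyBound` (`hL`) — every classical solution of the forced
Navier–Stokes system on `[0, T] × ℝ³` with `sup_{t ∈ [0,T]} ∫|u(t)|² < ∞`, force slices uniformly in
`L²` and force-potential slices `Δ⁻¹∇·f(t)` uniformly in `L²` (both automatic for Fefferman's class
(4)–(5)) is a Leray–Hopf weak solution on `[0, T)` from `u(0)` with force `f`, with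
`u ∈ C([0,T]; L²)`. CONDITIONAL on `hP`, `hL` only (the estimate of `X₅` is the tree's theorem
`tao2011_pressureTerm_estimate_holds`). [cite: Tao2011, Lemma 8.1 + Lemma 4.1 (i), with (9)] -/
theorem IsClassicalNSSolutionOn.isLerayHopfOn_of_finiteEnergy_forced
    (hP : tao2011_forced_pressure_normalisation) (hL : tao2011_forced_finiteEnergy_energyBound)
    (h : IsClassicalNSSolutionOn (Icc 0 T) ν f u p) (hν : 0 < ν) (hT : 0 < T)
    {Cf : ℝ≥0∞} (hCft : Cf ≠ ⊤) (hCf : ∀ t ∈ Icc 0 T, ∫⁻ x, ‖f t x‖ₑ ^ 2 ≤ Cf)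
    {Pf : ℝ≥0∞} (hPft : Pf ≠ ⊤)
    (hπm : ∀ t ∈ Icc 0 T, AEStronglyMeasurable (forcePotential (f t)) volume)
    (hπ : ∀ t ∈ Icc 0 T, ∫⁻ x, ‖forcePotential (f t) x‖ₑ ^ 2 ≤ Pf)
    (hfe : ∃ A : ℝ≥0∞, A < ⊤ ∧ ∀ t ∈ Icc 0 T, ∫⁻ x, ‖u t x‖ₑ ^ 2 ≤ A) :
    IsLerayHopfOn T ν f (u 0) u ∧ ContinuousInLpOn (Icc 0 T) 2 u := by
  obtain ⟨A, hAt, hA, -, hgrad⟩ := h.energyClass_of_finiteEnergy_forced hL hν hT hCft hCf hfe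
  exact h.isLerayHopfOn_of_finiteEnergy_forced' hP tao2011_pressureTerm_estimate_holds hν hT hCft hCf
    hPft hπm hπ hAt hA hgrad

/-- **The energy class and the forced energy EQUALITY packaged** (for consumers that want the
dissipation bound and the sharp balance rather than the Leray–Hopf structure): under the same
hypotheses, `∇u ∈ L²_{t,x}` and `½‖u(t)‖₂² + ν∫ₛᵗ∫|∇u|² = ½‖u(s)‖₂² + ∫ₛᵗ∫⟪f,u⟫` for all
`0 ≤ s ≤ t ≤ T`. [cite: Tao2011, Lemma 8.1 + Lemma 4.1 (i), with (9)] -/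
theorem IsClassicalNSSolutionOn.energyEq_of_finiteEnergy_forced_of_facts
    (hP : tao2011_forced_pressure_normalisation) (hL : tao2011_forced_finiteEnergy_energyBound)
    (h : IsClassicalNSSolutionOn (Icc 0 T) ν f u p) (hν : 0 < ν) (hT : 0 < T)
    {Cf : ℝ≥0∞} (hCft : Cf ≠ ⊤) (hCf : ∀ t ∈ Icc 0 T, ∫⁻ x, ‖f t x‖ₑ ^ 2 ≤ Cf)
    {Pf : ℝ≥0∞} (hPft : Pf ≠ ⊤)
    (hπm : ∀ t ∈ Icc 0 T, AEStronglyMeasurable (forcePotential (f t)) volume)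
    (hπ : ∀ t ∈ Icc 0 T, ∫⁻ x, ‖forcePotential (f t) x‖ₑ ^ 2 ≤ Pf)
    (hfe : ∃ A : ℝ≥0∞, A < ⊤ ∧ ∀ t ∈ Icc 0 T, ∫⁻ x, ‖u t x‖ₑ ^ 2 ≤ A) :
    (∫⁻ τ in Ioo 0 T, ∫⁻ x, ENNReal.ofReal (frobeniusNormSq (fderiv ℝ (u τ) x)) < ⊤) ∧
      ∀ {s t : ℝ}, 0 ≤ s → s ≤ t → t ≤ T → VectorCalculus.kineticEnergy (u t) +
        ν * (∫⁻ τ in Ioo s t, ∫⁻ x, ENNReal.ofReal (frobeniusNormSq (fderiv ℝ (u τ) x))).toReal =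
        VectorCalculus.kineticEnergy (u s) + ∫ τ in Ioo s t, ∫ x, ⟪f τ x, u τ x⟫ := by
  obtain ⟨A, hAt, hA, -, hgrad⟩ := h.energyClass_of_finiteEnergy_forced hL hν hT hCft hCf hfe
  exact ⟨hgrad, fun hs hst ht => h.energyEq_of_finiteEnergy_forced hP
    tao2011_pressureTerm_estimate_holds hν hT hCft hCf hPft hπm hπ hAt hA hgrad
    (h.lintegral_enorm_pow_three_lt_top_forced hAt hA hgrad) hs hst ht⟩

end Assembly

end Literature.Analysis.FluidPDE

end
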